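import Summits.QuantumFields.QCD.Theorems.WilsonMobilityGapChiralMobilityGapSketchDefs
import Summits.QuantumFields.QCD.Theorems.WilsonMobilityGapChiralMobilityGapStubMomentCompare
import Summits.QuantumFields.QCD.Theorems.WilsonMobilityGapMobilityGapPinchWard

/-!
# Crux `ChiralMobilityGap` (stmt-QuantumFields-17497) — line `Ideator3Sketch`: the vanishing chiral
# rate from SECOND and THIRD moments of the clause functional (`N_f ≥ 3`, any regularisation)

Helper file of the line lead (prover-line-stmt-QuantumFields-17497-c1-0).  The registered core stub
`stub_vcr` (vanishing chiral rate along degenerate tuples of the anchored witness) asks for clause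
(iii)-type LOWER bounds on the phase-quenched FRACTIONAL moments `fm(s) = E₊[X^s]`, `0 < s < 1`, of the
quark-propagator entry sum `X`.  This file reduces them, for `N_f ≥ 3` identical flavours and ANY
regularisation, to statements about the SECOND and THIRD moments of the SAME functional — the
physically standard quantities (`fm(2) = E₊[X²]` is the phase-quenched charged-pion correlator up to the
`ℓ¹/ℓ²` constant `144`, landed `fm_two_pionCorrelator_sandwich`):

* `rpow_moment_ge_of_third_moment` — abstract probability: `E[X³] ≤ K·E[X²]^{3/2}` and `E[X²] > 0` give
  `E[X^s] ≥ K^{s-2} E[X²]^{s/2}` (`0 < s < 2`; Hölder interpolation `moment_interpolation`, rearranged);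
* `integrable_propSum_cube` — at a degenerate tuple with `N_f ≥ 3` the cubed entry sum is phase-quenched
  integrable (`|det D|·X³ = |det D_W|^{N_f-3}(|det D_W| X)³ ≤ B^{N_f-3} M³`, `M` the adjugate entry sum);
* `fm_ge_of_fm_two_three` — hence `fm(s) ≥ K^{s-2} fm(2)^{s/2}` whenever `fm(3) ≤ K fm(2)^{3/2}`;
* `lowerWith_of_fm_two_three` — an exponential floor `c e^{-(μ a_k n + q log(n+1))} ≤ fm(2)` ("the
  phase-quenched pion correlator has physical mass `≤ μ`") and NO BROADENING
  `fm(3) ≤ K (n+1)^{q'} fm(2)^{3/2}` along a degenerate trajectory give clause (iii) there with rate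
  `C₁ = sμ/2`;
* `vanishingChiralRate_of_fm_two_three` — so `VanishingChiralRate reg` follows from a VANISHING pion
  rate (`inf_t μ(t) = 0`) plus no broadening: the honest physical content of the pin for `N_f = 3`
  (for `N_f = 2` the third moment is not phase-quenched integrable and this route is closed).
-/

noncomputable section

namespace Summit.QuantumFields.QCD.Theorems.ChiralMobilityGapAnchor

open scoped BigOperators Topology
open MeasureTheory Filter Set
open Literature.MathematicalPhysics.QuantumFieldTheory Literature.MathematicalPhysics.QuantumLattice
  Literature.Probability.LatticeModels
open Summit.QuantumFields.QCD.Theorems.MobilityGapSketch (propSum propSum_nonneg measurable_propSum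
  fm_eq_integral negativeFm_eq_fm)
open Summit.QuantumFields.QCD.Theorems.ChiralMobilityGapSketch (integrable_qcdLatticeMeasure_of_norm_det_mul_le
  LowerWith VanishingChiralRate)
open Summit.QuantumFields.QCD.Theorems.MobilityGapPinch (moment_interpolation)
open Summit.QuantumFields.QCD.Theorems.MobilityGapNegative (bare fm)

variable {Nf : ℕ}

/-! ### §1 Abstract probability: fractional moments from the second and third -/

/-- **Fractional moments from the second moment when the third does not broaden.** On a probability
space, for `X ≥ 0` with `E[X³] ≤ K · E[X²]^{3/2}` (`K > 0`) and `E[X²] > 0`: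
`E[X^s] ≥ K^{s-2} · E[X²]^{s/2}` for every `0 < s < 2` (Hölder interpolation
`E[X²] ≤ E[X^s]^{1/(3-s)} E[X³]^{(2-s)/(3-s)}`, landed as `moment_interpolation`, rearranged). -/
theorem rpow_moment_ge_of_third_moment {α : Type*} [MeasurableSpace α] {μ : Measure α}
    [IsProbabilityMeasure μ] {X : α → ℝ} (hX : Measurable X) (hX0 : ∀ a, 0 ≤ X a) {s : ℝ}
    (hs : 0 < s) (hs2 : s < 2) (hint : Integrable (fun a => X a ^ (3 : ℝ)) μ) {K : ℝ} (hK : 0 < K)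
    (hNB : ∫ a, X a ^ (3 : ℝ) ∂μ ≤ K * (∫ a, X a ^ (2 : ℝ) ∂μ) ^ (3 / 2 : ℝ))
    (hpos : 0 < ∫ a, X a ^ (2 : ℝ) ∂μ) :
    K ^ (s - 2) * (∫ a, X a ^ (2 : ℝ) ∂μ) ^ (s / 2) ≤ ∫ a, X a ^ s ∂μ := by
  set M2 : ℝ := ∫ a, X a ^ (2 : ℝ) ∂μ with hM2
  set Ms : ℝ := ∫ a, X a ^ s ∂μ with hMs
  set M3 : ℝ := ∫ a, X a ^ (3 : ℝ) ∂μ with hM3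
  have hMs0 : 0 ≤ Ms := integral_nonneg fun a => Real.rpow_nonneg (hX0 a) _
  have hM30 : 0 ≤ M3 := integral_nonneg fun a => Real.rpow_nonneg (hX0 a) _
  have h3s : 0 < 3 - s := by linarith
  have h2s : 0 < 2 - s := by linarith
  -- interpolation with `q = 3`
  have hI := moment_interpolation hX hX0 hs hs2 (by norm_num : (2 : ℝ) < 3) hint
  have he1 : ((3 : ℝ) - 2) / (3 - s) = 1 / (3 - s) := by norm_num
  rw [he1] at hI
  change M2 ≤ Ms ^ (1 / (3 - s)) * M3 ^ ((2 - s) / (3 - s)) at hI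
  -- `Ms > 0` (else `M2 ≤ 0`)
  have hMs_pos : 0 < Ms := by
    rcases hMs0.lt_or_eq with h | h
    · exact h
    · exfalso
      rw [← h, Real.zero_rpow (one_div_pos.2 h3s).ne', zero_mul] at hI
      exact absurd hI (not_le.2 hpos)
  -- raise to the power `3 - s`: `M2^{3-s} ≤ Ms · M3^{2-s}`
  have hI2 : M2 ^ (3 - s) ≤ Ms * M3 ^ (2 - s) := by
    have h := Real.rpow_le_rpow hpos.le hI h3s.le
    have hrhs : (Ms ^ (1 / (3 - s)) * M3 ^ ((2 - s) / (3 - s))) ^ (3 - s) = Ms * M3 ^ (2 - s) := by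
      rw [Real.mul_rpow (Real.rpow_nonneg hMs0 _) (Real.rpow_nonneg hM30 _),
        ← Real.rpow_mul hMs0, ← Real.rpow_mul hM30, one_div_mul_cancel h3s.ne',
        div_mul_cancel₀ _ h3s.ne', Real.rpow_one]
    rwa [hrhs] at h
  -- no broadening: `M3^{2-s} ≤ K^{2-s} M2^{3(2-s)/2}`
  have hNB2 : M3 ^ (2 - s) ≤ K ^ (2 - s) * M2 ^ (3 / 2 * (2 - s)) := by
    have h := Real.rpow_le_rpow hM30 hNB h2s.le
    rwa [Real.mul_rpow hK.le (Real.rpow_nonneg hpos.le _), ← Real.rpow_mul hpos.le] at h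
  -- combine and divide
  have hcomb : M2 ^ (3 - s) ≤ Ms * (K ^ (2 - s) * M2 ^ (3 / 2 * (2 - s))) :=
    hI2.trans (mul_le_mul_of_nonneg_left hNB2 hMs0)
  have hD : 0 < K ^ (2 - s) * M2 ^ (3 / 2 * (2 - s)) :=
    mul_pos (Real.rpow_pos_of_pos hK _) (Real.rpow_pos_of_pos hpos _)
  have hkey : M2 ^ (3 - s) / (K ^ (2 - s) * M2 ^ (3 / 2 * (2 - s))) ≤ Ms := by
    rw [div_le_iff₀ hD]; exact hcomb
  -- identify the left-hand side with `K^{s-2} M2^{s/2}`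
  have hL : M2 ^ (3 - s) / (K ^ (2 - s) * M2 ^ (3 / 2 * (2 - s))) = K ^ (s - 2) * M2 ^ (s / 2) := by
    rw [div_eq_iff hD.ne']
    symm
    have hK2 : K ^ (s - 2) * K ^ (2 - s) = 1 := by
      rw [← Real.rpow_add hK]; norm_num
    have hM : M2 ^ (s / 2) * M2 ^ (3 / 2 * (2 - s)) = M2 ^ (3 - s) := by
      rw [← Real.rpow_add hpos]; congr 1; ring
    calc K ^ (s - 2) * M2 ^ (s / 2) * (K ^ (2 - s) * M2 ^ (3 / 2 * (2 - s)))
        = (K ^ (s - 2) * K ^ (2 - s)) * (M2 ^ (s / 2) * M2 ^ (3 / 2 * (2 - s))) := by ring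
      _ = M2 ^ (3 - s) := by rw [hK2, hM, one_mul]
  rwa [hL] at hkey


/-! ### §2 Integrability of the cubed entry sum at a degenerate tuple, `N_f ≥ 3` -/

/-- The colour–spin sum of adjugate entries of the one-flavour Wilson matrix between `0` and `v`:
a CONTINUOUS majorant of `|det D_W| · X_{f,v}` (`X` the propagator entry sum). -/
theorem norm_det_mul_propSum_le_adjSum (S : ℕ) (t : ℝ) (f : Fin Nf) (v : Site 4)
    (U : GaugeConfig 4 (2 * S + 1) SU3) :
    ‖(wilsonDirac (fundamentalRep (Fin 3)) U t 1).det‖ * propSum Nf S (fun _ => t) f v U ≤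
      ∑ a : Fin 3, ∑ i : Fin 4, ∑ b : Fin 3, ∑ j : Fin 4,
        ‖(wilsonDirac (fundamentalRep (Fin 3)) U t 1).adjugate (Torus.proj (2 * S + 1) 0, a, i)
          (Torus.proj (2 * S + 1) v, b, j)‖ := by
  by_cases h0 : (wilsonDirac (fundamentalRep (Fin 3)) U t 1).det = 0
  · rw [h0, norm_zero, zero_mul]
    positivity
  · unfold propSum
    simp only [Finset.mul_sum]
    refine Finset.sum_le_sum fun a _ => Finset.sum_le_sum fun i _ => Finset.sum_le_sum fun b _ =>
      Finset.sum_le_sum fun j _ => ?_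
    rw [inv_diracMatrix_apply_same_flavour U (fun _ : Fin Nf => t) (fun _ => h0) f]
    exact norm_det_mul_norm_inv_apply_le _ _ _

/-- **Pointwise cube bound at a degenerate tuple, `N_f ≥ 3`.** `|det D| · X³ ≤ B^{N_f-3} · M³` whenever
`|det D_W| ≤ B` and the adjugate entry sum is `≤ M` (`|det D| = |det D_W|^{N_f}`, `|det D_W|·X ≤ M`). -/
theorem norm_det_mul_propSum_cube_le (hNf : 3 ≤ Nf) (S : ℕ) (t : ℝ) (f : Fin Nf) (v : Site 4)
    (U : GaugeConfig 4 (2 * S + 1) SU3) {B M : ℝ}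
    (hB : ‖(wilsonDirac (fundamentalRep (Fin 3)) U t 1).det‖ ≤ B)
    (hM : ∑ a : Fin 3, ∑ i : Fin 4, ∑ b : Fin 3, ∑ j : Fin 4,
        ‖(wilsonDirac (fundamentalRep (Fin 3)) U t 1).adjugate (Torus.proj (2 * S + 1) 0, a, i)
          (Torus.proj (2 * S + 1) v, b, j)‖ ≤ M) :
    ‖(diracMatrix U (fun _ : Fin Nf => t)).det‖ * propSum Nf S (fun _ => t) f v U ^ (3 : ℝ) ≤
      B ^ (Nf - 3) * M ^ 3 := by
  set d : ℝ := ‖(wilsonDirac (fundamentalRep (Fin 3)) U t 1).det‖ with hd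
  have hd0 : 0 ≤ d := norm_nonneg _
  have hP0 := propSum_nonneg Nf S (fun _ : Fin Nf => t) f v U
  have hdet : ‖(diracMatrix U (fun _ : Fin Nf => t)).det‖ = d ^ Nf := by
    rw [norm_det_diracMatrix, Finset.prod_const, Finset.card_univ, Fintype.card_fin]
  have hdP : d * propSum Nf S (fun _ => t) f v U ≤ M :=
    (norm_det_mul_propSum_le_adjSum S t f v U).trans hM
  have hM0 : 0 ≤ M := (mul_nonneg hd0 hP0).trans hdP
  have hB0 : 0 ≤ B := hd0.trans hB
  have h3 : propSum Nf S (fun _ => t) f v U ^ (3 : ℝ) = propSum Nf S (fun _ => t) f v U ^ (3 : ℕ) := by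
    rw [show (3 : ℝ) = ((3 : ℕ) : ℝ) by norm_num, Real.rpow_natCast]
  rw [hdet, h3]
  have hsplit : d ^ Nf * propSum Nf S (fun _ => t) f v U ^ 3 =
      d ^ (Nf - 3) * (d * propSum Nf S (fun _ => t) f v U) ^ 3 := by
    rw [mul_pow, ← mul_assoc, ← pow_add, Nat.sub_add_cancel hNf]
  rw [hsplit]
  exact mul_le_mul (pow_le_pow_left₀ hd0 hB _) (pow_le_pow_left₀ (mul_nonneg hd0 hP0) hdP 3)
    (pow_nonneg (mul_nonneg hd0 hP0) 3) (pow_nonneg hB0 _)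

/-- The constants by compactness: `|det D_W(·,t,1)|` and the adjugate entry sum are continuous on the
compact configuration space, hence bounded; so `|det D| · X³ ≤ K` uniformly. -/
theorem exists_norm_det_mul_propSum_cube_le (hNf : 3 ≤ Nf) (S : ℕ) (t : ℝ) (f : Fin Nf) (v : Site 4) :
    ∃ K : ℝ, ∀ U : GaugeConfig 4 (2 * S + 1) SU3,
      ‖(diracMatrix U (fun _ : Fin Nf => t)).det‖ * propSum Nf S (fun _ => t) f v U ^ (3 : ℝ) ≤ K := by
  have hc : Continuous fun U : GaugeConfig 4 (2 * S + 1) SU3 => wilsonDirac (fundamentalRep (Fin 3)) U t 1 :=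
    continuous_wilsonDirac (fundamentalRep (Fin 3)) (continuous_fundamentalRep (Fin 3)) t 1
  have hA : Continuous fun U : GaugeConfig 4 (2 * S + 1) SU3 =>
      ∑ a : Fin 3, ∑ i : Fin 4, ∑ b : Fin 3, ∑ j : Fin 4,
        ‖(wilsonDirac (fundamentalRep (Fin 3)) U t 1).adjugate (Torus.proj (2 * S + 1) 0, a, i)
          (Torus.proj (2 * S + 1) v, b, j)‖ := by
    refine continuous_finsetSum _ fun a _ => continuous_finsetSum _ fun i _ =>
      continuous_finsetSum _ fun b _ => continuous_finsetSum _ fun j _ => ?_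
    exact (hc.matrix_adjugate.matrix_elem _ _).norm
  obtain ⟨U₁, -, hU₁⟩ := (isCompact_univ (X := GaugeConfig 4 (2 * S + 1) SU3)).exists_isMaxOn
    Set.univ_nonempty hc.matrix_det.norm.continuousOn
  obtain ⟨U₂, -, hU₂⟩ := (isCompact_univ (X := GaugeConfig 4 (2 * S + 1) SU3)).exists_isMaxOn
    Set.univ_nonempty hA.continuousOn
  exact ⟨_, fun U => norm_det_mul_propSum_cube_le hNf S t f v U (hU₁ (Set.mem_univ U))
    (hU₂ (Set.mem_univ U))⟩

/-- **The cubed entry sum is phase-quenched integrable at a degenerate tuple with `N_f ≥ 3`.** -/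
theorem integrable_propSum_cube (hNf : 3 ≤ Nf) (S : ℕ) (β t : ℝ) (f : Fin Nf) (v : Site 4) :
    Integrable (fun U : GaugeConfig 4 (2 * S + 1) SU3 => propSum Nf S (fun _ => t) f v U ^ (3 : ℝ))
      (qcdLatticeMeasure (2 * S + 1) β (fun _ : Fin Nf => t)) := by
  obtain ⟨K, hK⟩ := exists_norm_det_mul_propSum_cube_le hNf S t f v
  exact integrable_qcdLatticeMeasure_of_norm_det_mul_le β _ _
    ((measurable_propSum Nf S _ f v).pow_const _) (fun U => Real.rpow_nonneg (propSum_nonneg _ _ _ _ _ _) _) hK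


/-! ### §3 `fm(s) ≥ K^{s-2} fm(2)^{s/2}` at a degenerate tuple -/

/-- **Fractional moments of the clause functional from its second and third moments** (degenerate
tuple, `N_f ≥ 3`, `0 < s < 2`): if `fm(3) ≤ K · fm(2)^{3/2}` with `K > 0` and `fm(2) > 0` then
`K^{s-2} · fm(2)^{s/2} ≤ fm(s)` — all three are moments of the entry sum `X` under the phase-quenched
probability measure `qcdLatticeMeasure`. -/
theorem fm_ge_of_fm_two_three (hNf : 3 ≤ Nf) (β t : ℝ) (S : ℕ) (f : Fin Nf) (v : Site 4) {s : ℝ}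
    (hs : 0 < s) (hs2 : s < 2) {K : ℝ} (hK : 0 < K)
    (hNB : fm Nf β (fun _ => t) S f v 3 ≤ K * fm Nf β (fun _ => t) S f v 2 ^ (3 / 2 : ℝ))
    (hpos : 0 < fm Nf β (fun _ => t) S f v 2) :
    K ^ (s - 2) * fm Nf β (fun _ => t) S f v 2 ^ (s / 2) ≤ fm Nf β (fun _ => t) S f v s := by
  haveI := isProbabilityMeasure_qcdLatticeMeasure_all (S := 2 * S + 1) β (fun _ : Fin Nf => t)
  rw [negativeFm_eq_fm] at *
  rw [fm_eq_integral] at hNB hpos ⊢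
  rw [fm_eq_integral] at hNB ⊢
  exact rpow_moment_ge_of_third_moment (measurable_propSum Nf S _ f v) (propSum_nonneg Nf S _ f v) hs hs2
    (integrable_propSum_cube hNf S β t f v) hK hNB hpos

/-! ### §4 Clause (iii) with its rate, and the vanishing chiral rate -/

/-- **Clause (iii) along a degenerate trajectory from a pion-type floor and no broadening** (`N_f ≥ 3`).
If eventually in `k`, on every torus `S ≥ L_k`, for every flavour and every `n ≤ S`,
`c e^{-(μ a_k n + q log(n+1))} ≤ fm(2)` (`c > 0`) and `fm(3) ≤ K e^{q' log(n+1)} fm(2)^{3/2}` (`K > 0`),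
then `LowerWith reg (t,…,t) s (K^{s-2} c^{s/2}) (sμ/2) (q s/2 + q'(2-s))` for every `0 < s < 2`. -/
theorem lowerWith_of_fm_two_three (hNf : 3 ≤ Nf) (reg : QCDRegularisation Nf) (t : ℝ) {s : ℝ}
    (hs : 0 < s) (hs2 : s < 2) {c μ q K q' : ℝ} (hc : 0 < c) (hK : 0 < K)
    (hPF : ∀ᶠ k in atTop, ∀ S : ℕ, reg.L k ≤ S → ∀ (f : Fin Nf) (n : ℕ), n ≤ S →
      c * Real.exp (-(μ * (reg.a k * n) + q * Real.log (n + 1))) ≤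
        fm Nf (reg.β k) (bare reg (fun _ => t) k) S f (Pi.single 0 (n : ℤ)) 2)
    (hNB : ∀ᶠ k in atTop, ∀ S : ℕ, reg.L k ≤ S → ∀ (f : Fin Nf) (n : ℕ), n ≤ S →
      fm Nf (reg.β k) (bare reg (fun _ => t) k) S f (Pi.single 0 (n : ℤ)) 3 ≤
        K * Real.exp (q' * Real.log (n + 1)) *
          fm Nf (reg.β k) (bare reg (fun _ => t) k) S f (Pi.single 0 (n : ℤ)) 2 ^ (3 / 2 : ℝ)) :
    LowerWith reg (fun _ => t) s (K ^ (s - 2) * c ^ (s / 2)) (s * μ / 2) (q * s / 2 + q' * (2 - s)) := by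
  filter_upwards [hPF, hNB] with k hPFk hNBk S hS f n hn
  -- read the two inputs at the constant tuple `x_k = m_crit(k) + a_k t / Z_m(k)`
  have h1 : c * Real.exp (-(μ * (reg.a k * n) + q * Real.log (n + 1))) ≤
      fm Nf (reg.β k) (fun _ : Fin Nf => reg.mcrit k + reg.a k * t / reg.Zm k) S f (Pi.single 0 (n : ℤ)) 2 :=
    hPFk S hS f n hn
  have h2 : fm Nf (reg.β k) (fun _ : Fin Nf => reg.mcrit k + reg.a k * t / reg.Zm k) S f (Pi.single 0 (n : ℤ)) 3 ≤
      (K * Real.exp (q' * Real.log (n + 1))) *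
        fm Nf (reg.β k) (fun _ : Fin Nf => reg.mcrit k + reg.a k * t / reg.Zm k) S f (Pi.single 0 (n : ℤ)) 2 ^
          (3 / 2 : ℝ) :=
    hNBk S hS f n hn
  have hKn : 0 < K * Real.exp (q' * Real.log (n + 1)) := mul_pos hK (Real.exp_pos _)
  have hE0 : 0 < c * Real.exp (-(μ * (reg.a k * n) + q * Real.log (n + 1))) := mul_pos hc (Real.exp_pos _)
  have hF2pos : 0 < fm Nf (reg.β k) (fun _ : Fin Nf => reg.mcrit k + reg.a k * t / reg.Zm k) S f
      (Pi.single 0 (n : ℤ)) 2 := hE0.trans_le h1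
  have hmain := fm_ge_of_fm_two_three hNf (reg.β k) (reg.mcrit k + reg.a k * t / reg.Zm k) S f
    (Pi.single 0 (n : ℤ)) hs hs2 hKn h2 hF2pos
  refine le_trans ?_ hmain
  -- constants: `K^{s-2} c^{s/2} e^{-((sμ/2) a n + (qs/2 + q'(2-s)) log(n+1))} = Kn^{s-2} (c e^{…})^{s/2} ≤ Kn^{s-2} fm(2)^{s/2}`
  have hstep : (c * Real.exp (-(μ * (reg.a k * n) + q * Real.log (n + 1)))) ^ (s / 2) ≤
      fm Nf (reg.β k) (fun _ : Fin Nf => reg.mcrit k + reg.a k * t / reg.Zm k) S f (Pi.single 0 (n : ℤ)) 2 ^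
        (s / 2) :=
    Real.rpow_le_rpow hE0.le h1 (by linarith)
  refine le_trans (le_of_eq ?_) (mul_le_mul_of_nonneg_left hstep (Real.rpow_nonneg hKn.le _))
  rw [Real.mul_rpow hK.le (Real.exp_pos _).le, Real.mul_rpow hc.le (Real.exp_pos _).le,
    ← Real.exp_mul, ← Real.exp_mul]
  have hexp : Real.exp (-(s * μ / 2 * (reg.a k * n) + (q * s / 2 + q' * (2 - s)) * Real.log (n + 1))) =
      Real.exp (q' * Real.log (n + 1) * (s - 2)) *
        Real.exp (-(μ * (reg.a k * n) + q * Real.log (n + 1)) * (s / 2)) := by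
    rw [← Real.exp_add]
    congr 1
    ring
  rw [hexp]
  ring

/-- **The vanishing chiral rate from second and third moments** (`N_f ≥ 3`, any regularisation).  If
for every `ε > 0` some positive `t` carries, along the degenerate trajectory `(t,…,t)`, an exponential
floor for `fm(2)` with physical rate `μ < ε` ("the phase-quenched pion mass vanishes with `t`") and the
third moment does not broaden (`fm(3) ≤ K (n+1)^{q'} fm(2)^{3/2}`), then `VanishingChiralRate reg` —
hence, by the landed pin lemmas, the chiral pin of the crux for that regularisation. -/
theorem vanishingChiralRate_of_fm_two_three : ∀ {Nf : ℕ}, 3 ≤ Nf → ∀ reg : QCDRegularisation Nf, (∀ ε > (0 : ℝ), ∃ t : ℝ, 0 < t ∧ ∃ c μ q : ℝ, 0 < c ∧ μ < ε ∧ (∀ᶠ k in atTop, ∀ S : ℕ, reg.L k ≤ S → ∀ (f : Fin Nf) (n : ℕ), n ≤ S → c * Real.exp (-(μ * (reg.a k * n) + q * Real.log (n + 1))) ≤ fm Nf (reg.β k) (bare reg (fun _ => t) k) S f (Pi.single 0 (n : ℤ)) 2) ∧ ∃ K q' : ℝ, 0 < K ∧ ∀ᶠ k in atTop, ∀ S :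 ℕ, reg.L k ≤ S → ∀ (f : Fin Nf) (n : ℕ), n ≤ S → fm Nf (reg.β k) (bare reg (fun _ => t) k) S f (Pi.single 0 (n : ℤ)) 3 ≤ K * Real.exp (q' * Real.log (n + 1)) * fm Nf (reg.β k) (bare reg (fun _ => t) k) S f (Pi.single 0 (n : ℤ)) 2 ^ (3 / 2 : ℝ)) → VanishingChiralRate reg := by
  intro Nf hNf reg hPF ε hε
  obtain ⟨t, ht, c, μ, q, hc, hμ, hF, K, q', hK, hB⟩ := hPF ε hε
  refine ⟨t, ht, 1 / 2, K ^ ((1 / 2 : ℝ) - 2) * c ^ ((1 / 2 : ℝ) / 2), 1 / 2 * μ / 2,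
    q * (1 / 2) / 2 + q' * (2 - 1 / 2), by norm_num, by norm_num, ?_, ?_, ?_⟩
  · exact mul_pos (Real.rpow_pos_of_pos hK _) (Real.rpow_pos_of_pos hc _)
  · linarith
  · exact lowerWith_of_fm_two_three hNf reg t (by norm_num) (by norm_num) hc hK hF hB

end Summit.QuantumFields.QCD.Theorems.ChiralMobilityGapAnchor

end
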